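import Mathlib
import Summits.Ventures.PercRepro2.LocRows
import Summits.Ventures.PercRepro2.SwRow
import Summits.Ventures.PercRepro2.SwOut
import Summits.Ventures.PercRepro2.SwAllRow
import Summits.Ventures.PercRepro2.SwOutAll
import Summits.Ventures.PercRepro2.SwOutArmFlip
import Summits.Ventures.PercRepro2.SwOutArmThm
import Summits.Ventures.PercRepro2.SwOutCoreDefs
import Summits.Ventures.PercRepro2.SwOutCoreDual
import Summits.Ventures.PercRepro2.SwOutShadowDefs
import Summits.Ventures.PercRepro2.SwOutCoreShadowDefs
import Summits.Ventures.PercRepro2.SwOutCoreShadowFlip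
import Summits.Ventures.PercRepro2.SwOutCoreToggle
import Summits.Ventures.PercRepro2.SwOutEdgeDefs
import Summits.Ventures.PercRepro2.SwOutEdgeShadow
import Summits.Ventures.PercRepro2.SwOutEdgeShadowFlip

/-!
# Toggles along the e-core cube (blind cell PercRepro2, night-4 g16, 2026-08-26;
proofs/NIGHT4-G15.md §4 (L4), proofs/NIGHT4-G16.md §3)

The toggle bookkeeping of `SwOutCoreToggle` for an e-core base (the junction `u` adjacent to
`h`).  Flipping a selection of arms toggles those arm coordinates of an e-cube point and leaves
the h–u edges alone (`CoreBaseE.flip_armsSel_coreRealE`).  THE DIFFERENCE WITH THE NON-ADJACENT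
CASE: the mirror flip `flip (sX ∪ sZ)` of the shadow data of a one-sided point flips the arms
adjacent to `u` AND the h–u edges (`u ∈ sX`): `touches_sXZ_eq` has the h–u edges as an extra
term, and the mirror flip toggles the u-adjacent coordinates together with the e-coordinate
(`CoreBaseE.flip_sXZ_coreRealE`, `toggleE`).
-/

namespace Summit.Ventures.PercRepro2

namespace LocRows

open Hull

variable {V : Type*} {E : Type*}

open scoped Classical

variable {ends : E → Sym2 V}

section ToggleE

variable {ι : Type*}

/-- The toggle of an e-cube point on the e-coordinate and on the arms selected by `p`. -/
noncomputable def toggleE (p : ι → Prop) (ω : Config (Option ι)) : Config (Option ι) :=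
  fun j => match j with
    | none => !ω none
    | some i => if p i then !ω (some i) else ω (some i)

/-- `toggleE` on the e-coordinate. -/
lemma toggleE_none (p : ι → Prop) (ω : Config (Option ι)) : toggleE p ω none = !ω none := rfl

/-- `toggleE` on the arm coordinates is the toggle. -/
lemma toggleE_comp_some (p : ι → Prop) (ω : Config (Option ι)) :
    toggleE p ω ∘ some = toggle p (ω ∘ some) := by
  funext i; rfl

/-- The toggle of the arm coordinates, with the e-coordinate kept. -/
noncomputable def toggleArms (p : ι → Prop) (ω : Config (Option ι)) : Config (Option ι) :=
  fun j => match j with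
    | none => ω none
    | some i => if p i then !ω (some i) else ω (some i)

/-- `toggleArms` on the e-coordinate. -/
lemma toggleArms_none (p : ι → Prop) (ω : Config (Option ι)) : toggleArms p ω none = ω none := rfl

/-- `toggleArms` on the arm coordinates is the toggle. -/
lemma toggleArms_comp_some (p : ι → Prop) (ω : Config (Option ι)) :
    toggleArms p ω ∘ some = toggle p (ω ∘ some) := by
  funext i; rfl

end ToggleE

section Core

variable {ι : Type*} {A : ι → Set V} {pure : ι → Prop} {ζ : Config E} {h u : V} {H : Set V}
  (hb : CoreBaseE ends ζ h u H A pure)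
include hb

/-- An edge with an end in `A i` touches the selection `armsSel A p` iff `p i`. -/
lemma CoreBaseE.mem_touches_armsSel_iff {p : ι → Prop} {i : ι} {e : E} {x y : V}
    (hxy : ends e = s(x, y)) (hx : x ∈ A i) : e ∈ touches ends (armsSel A p) ↔ p i := by
  constructor
  · rintro ⟨z, ⟨j, hj, hz⟩, w, hzw⟩
    rw [hxy, Sym2.eq_iff] at hzw
    rcases hzw with ⟨h1, _⟩ | ⟨_, h2⟩
    · rw [← h1] at hz
      have hji : j = i := by
        by_contra hne
        exact hb.arm_disj j i hne x hz hx
      rw [← hji]; exact hj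
    · rw [← h2] at hz
      have hij : i = j := hb.arm_eq_of_edge hxy hx hz
      rw [hij]; exact hj
  · intro hi
    exact ⟨x, ⟨i, hi, hx⟩, y, hxy⟩

/-- **Flipping a selection of arms toggles those arm coordinates of an e-cube point** (the h–u
edges are untouched). -/
theorem CoreBaseE.flip_armsSel_coreRealE (p : ι → Prop) (ω : Config (Option ι)) :
    flip ends (armsSel A p) (coreRealE ends A h u ζ ω) =
      coreRealE ends A h u ζ (toggleArms p ω) := by
  funext e
  by_cases hhu : ends e = s(h, u)
  · rw [flip_apply_of_notMem (fun h' => hb.hu_not_touches hhu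
      (touches_mono (armsSel_subset_allArms A p) h')),
      CoreBaseE.coreRealE_apply_hu (A := A) (ζ := ζ) hhu,
      CoreBaseE.coreRealE_apply_hu (A := A) (ζ := ζ) hhu, toggleArms_none]
  by_cases he : e ∈ touches ends (allArms A)
  · obtain ⟨i, x, y, hxy, hx⟩ := CoreBase.exists_arm_of_touches_allArms he
    rw [hb.coreRealE_apply_of_mem (ω := toggleArms p ω) hxy hx]
    have hta : toggleArms p ω (some i) = if p i then !ω (some i) else ω (some i) := rfl
    rw [hta]
    by_cases hp : p i
    · rw [flip_apply_of_mem ((hb.mem_touches_armsSel_iff hxy hx).2 hp),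
        hb.coreRealE_apply_of_mem (ω := ω) hxy hx, if_pos hp]
      cases ω (some i) <;> simp
    · rw [flip_apply_of_notMem (fun h' => hp ((hb.mem_touches_armsSel_iff hxy hx).1 h')),
        hb.coreRealE_apply_of_mem (ω := ω) hxy hx, if_neg hp]
  · rw [flip_apply_of_notMem (fun h' => he (touches_mono (armsSel_subset_allArms A p) h')),
      CoreBaseE.coreRealE_apply_of_notMem he hhu, CoreBaseE.coreRealE_apply_of_notMem he hhu]

/-- An edge touching `sX ∪ sZ` touches the arms adjacent to `u` or is an h–u edge, and
conversely. -/
lemma CoreBaseE.touches_sXZ_eq (ω₀ : Config ι) :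
    touches ends (sX ends u A ω₀ ∪ sZ ends u A ω₀) =
      touches ends (armsSel A (uAdjC ends u A)) ∪ huEdges ends h u := by
  ext e
  constructor
  · rintro ⟨x, hx, y, hxy⟩
    rcases hx with hx | hx
    · rcases mem_sX_iff.1 hx with rfl | ⟨i, hi, _, hxi⟩
      · rcases hb.u_edges e y hxy with rfl | ⟨j, hyj⟩
        · exact Or.inr (by rw [mem_huEdges_iff, hxy, Sym2.eq_swap])
        · exact Or.inl ⟨y, ⟨j, ⟨e, y, hxy, hyj⟩, hyj⟩, x, ends_swap hxy⟩
      · exact Or.inl ⟨x, ⟨i, hi, hxi⟩, y, hxy⟩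
    · obtain ⟨i, hi, _, hxi⟩ := hx
      exact Or.inl ⟨x, ⟨i, hi, hxi⟩, y, hxy⟩
  · rintro (⟨x, ⟨i, hi, hxi⟩, y, hxy⟩ | hhu)
    · cases hω : ω₀ i with
      | true => exact ⟨x, Or.inl (mem_sX_iff.2 (Or.inr ⟨i, hi, hω, hxi⟩)), y, hxy⟩
      | false => exact ⟨x, Or.inr ⟨i, hi, hω, hxi⟩, y, hxy⟩
    · rw [mem_huEdges_iff] at hhu
      exact ⟨u, Or.inl (mem_sX_iff.2 (Or.inl rfl)), h, by rw [hhu, Sym2.eq_swap]⟩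

/-- **The mirror flip toggles the u-adjacent coordinates and the e-coordinate of an e-cube
point.** -/
theorem CoreBaseE.flip_sXZ_coreRealE (ω₀ : Config ι) (ω : Config (Option ι)) :
    flip ends (sX ends u A ω₀ ∪ sZ ends u A ω₀) (coreRealE ends A h u ζ ω) =
      coreRealE ends A h u ζ (toggleE (uAdjC ends u A) ω) := by
  funext e
  by_cases hhu : ends e = s(h, u)
  · have hmem : e ∈ touches ends (sX ends u A ω₀ ∪ sZ ends u A ω₀) := by
      rw [hb.touches_sXZ_eq]; exact Or.inr hhu
    rw [flip_apply_of_mem hmem, CoreBaseE.coreRealE_apply_hu (A := A) (ζ := ζ) hhu,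
      CoreBaseE.coreRealE_apply_hu (A := A) (ζ := ζ) hhu, toggleE_none]
    cases ω none <;> simp
  · have hnot_hu : e ∉ huEdges ends h u := hhu
    have hiff : e ∈ touches ends (sX ends u A ω₀ ∪ sZ ends u A ω₀) ↔
        e ∈ touches ends (armsSel A (uAdjC ends u A)) := by
      rw [hb.touches_sXZ_eq, Set.mem_union]
      exact ⟨fun h' => h'.resolve_right hnot_hu, fun h' => Or.inl h'⟩
    have hflip : flip ends (sX ends u A ω₀ ∪ sZ ends u A ω₀) (coreRealE ends A h u ζ ω) e =
        flip ends (armsSel A (uAdjC ends u A)) (coreRealE ends A h u ζ ω) e := by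
      by_cases hm : e ∈ touches ends (armsSel A (uAdjC ends u A))
      · rw [flip_apply_of_mem (hiff.2 hm), flip_apply_of_mem hm]
      · rw [flip_apply_of_notMem (fun h' => hm (hiff.1 h')), flip_apply_of_notMem hm]
    rw [hflip, hb.flip_armsSel_coreRealE]
    -- the arm toggle and the e-toggle agree on every edge other than the h–u edges
    by_cases he : e ∈ touches ends (allArms A)
    · obtain ⟨i, x, y, hxy, hx⟩ := CoreBase.exists_arm_of_touches_allArms he
      rw [hb.coreRealE_apply_of_mem hxy hx, hb.coreRealE_apply_of_mem hxy hx]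
      rfl
    · rw [CoreBaseE.coreRealE_apply_of_notMem he hhu, CoreBaseE.coreRealE_apply_of_notMem he hhu]

end Core

end LocRows

end Summit.Ventures.PercRepro2
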